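import Mathlib
import HarnessLib

/-!
# Route `PrintCf2`, crux stmt-BirchSwinnertonDyer-20509 `RamifiedOffTYZOfFacts`, THEOREM A's TRANSFER STEP in the kernel (abstract form):
# the half-norm of a Kummer generator over a transversal, and the transfer as a power map
# (cell `bsd-print-cf2`, LEAD cruxlead-20509 g32, line `offtyz-v7`, lineage cycle 33; fact-free, Theses-free, `def`-free)

HONEST FRAMING (`--supports stmt-BirchSwinnertonDyer-20509`; theorems only).  BSD is not proved by any of this; no class is closed by this file;
item 23431 (C⁺) and crux 20509 stay OPEN.  This is §2c («Transfer») of g29's THEOREM A (memo `Cruxes/RamifiedOffTYZOfFacts/Lines/offtyz_v7_ExactDescent.md`)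
as PURE ALGEBRA, the one step of THEOREM A's road (skeleton v11, stub `stub_offTYZ_firstNormSquare_R2`) that needs neither the analytic identity
`x∘i₀ = s²` nor Shimura reciprocity.

Setting: a COMMUTATIVE group `G` acting on a commutative ring `F` by ring automorphisms (`MulSemiringAction G F`), an element `s ∈ F`,
a subgroup `H ≤ G` acting on `s` through SIGNS (`h • s = s` or `h • s = −s` for `h ∈ H`; e.g. `H` = the stabiliser of `a = s²`), and a finite
set `T ⊂ G` of representatives of the cosets of `H` (`∀ g, ∃! t ∈ T, t⁻¹g ∈ H`).  The «half-norm» of `s` is `P := ∏_{t ∈ T} t • s`; its square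
is the honest norm-type product `∏_{t∈T} t • s²` of the conjugates of `a = s²` over the transversal.

* `prod_transversal_cocycle_eq_pow` — the TRANSFER IS THE POWER MAP in a commutative group: writing `g·t = π_g(t)·h_{g,t}` (`π_g(t) ∈ T`,
  `h_{g,t} ∈ H`), `∏_{t∈T} h_{g,t} = g^{#T}` (so in particular `g^{#T} ∈ H`, `pow_card_transversal_mem`).
* `smul_halfNorm_eq_of_pow_card_smul` — ★ if `g^{#T} • s = s` then `g • P = P`; hence (`halfNorm_mem_fixed_of_forall_pow_card_smul`) if EVERY
  `g^{#T}` fixes `s`, the half-norm `P` is `G`-invariant — and `P² = ∏_{t∈T} t • s²` (`halfNorm_sq`): the transversal product of the conjugates of `s²`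
  is the square of a `G`-INVARIANT element.  (Kummer reading: for `R′/k` abelian with group `G`, `a = s² ∈ R′`, the class of `N = ∏_{t} t•a` in
  `k^×/k^{×2}` is `χ_s ∘ Ver`, `Ver : G → H` the transfer `= (·)^{[G:H]}`; [NSW] §1.5.)
* `smul_halfNorm_eq_neg_of_pow_card_smul` — conversely if `g^{#T} • s = −s` then `g • P = −P`.
* `pow_card_smul_eq_of_even_of_sq_smul_ne` — ★ the ORDER-TWO CRITERION: if `#T` is even and NO `g ∈ G` has `g² • s = −s` («the sign element is
  not a square in `G`»), then every `g^{#T}` fixes `s` (so the half-norm is `G`-invariant, `halfNorm_mem_fixed_of_even_of_sq_smul_ne`).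

Use (prover's note, crux stmt-BirchSwinnertonDyer-20509, THEOREM A of the line `offtyz-v7`): with `R′ ⊂ K^{(32)}(i)` abelian over `K = ℚ(√−n)`,
`G = Gal(R′/L_n(i))`, `s = η₁₆³/(η₈η₃₂²)` at the level-`32` Heegner point (`s² = x(z_n)`), `H = Gal(R′/H_n(i))`, `T` ↔ `Gal(H_n(i)/L_n(i)) = 2Cl`:
the first norm `N_{H/L} x(z_n)` is the square of the half-norm, which lies in `L_n(i)` as soon as `#2Cl = g(n)` is even (`4 ∣ h(−n)`) and no
square in `G` acts by `−1` on `s` (Shimura reciprocity: on `R2` every candidate acts through `(2/γ)`, `γ ∈ ⟨−1, l, q⟩`, `l ≡ 1`, `q ≡ 7 (mod 8)`).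
PROOFS ONLY: no `def`, no named fact; pure algebra, no field or characteristic hypothesis except where stated.

References: [cite: NeukirchSchmidtWingberg2008, §1.5 (cor = N on H⁰/Kummer classes; Ver)]; transfer into a subgroup of an abelian group is the
power map `x ↦ x^{[G:H]}` [folklore] (Mathlib `MonoidHom.transfer_eq_pow` for central subgroups).
-/

namespace Summit.BirchSwinnertonDyer.PrintCf2.HalfNormTransfer

open Finset

variable {G F : Type*} [CommGroup G] [CommRing F] [MulSemiringAction G F]

/-! ## §1 Transversal bookkeeping in a commutative group -/

/-- For a transversal `T` of `H` in the commutative group `G` (`∀ g, ∃! t ∈ T, t⁻¹ g ∈ H`) and `g ∈ G`, the re-indexing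
`t ↦ π_g(t)` (the representative of `g t`) maps `T` to `T`. [folklore] -/
theorem transversal_rep_mem {H : Subgroup G} {T : Finset G} (hT : ∀ g : G, ∃! t, t ∈ T ∧ t⁻¹ * g ∈ H) (g t : G) :
    Classical.choose (hT (g * t)).exists ∈ T :=
  (Classical.choose_spec (hT (g * t)).exists).1

/-- The cocycle `h_{g,t} = π_g(t)⁻¹ (g t)` lies in `H`. [folklore] -/
theorem transversal_cocycle_mem {H : Subgroup G} {T : Finset G} (hT : ∀ g : G, ∃! t, t ∈ T ∧ t⁻¹ * g ∈ H) (g t : G) :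
    (Classical.choose (hT (g * t)).exists)⁻¹ * (g * t) ∈ H :=
  (Classical.choose_spec (hT (g * t)).exists).2

/-- The re-indexing `t ↦ π_g(t)` is injective on `T`. [folklore] -/
theorem transversal_rep_injOn {H : Subgroup G} {T : Finset G} (hT : ∀ g : G, ∃! t, t ∈ T ∧ t⁻¹ * g ∈ H) (g : G) :
    Set.InjOn (fun t => Classical.choose (hT (g * t)).exists) T := by
  intro t₁ ht₁ t₂ ht₂ h
  simp only at h
  have h₁ := transversal_cocycle_mem hT g t₁
  have h₂ := transversal_cocycle_mem hT g t₂
  rw [h] at h₁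
  -- `t₁⁻¹ t₂ ∈ H`, so `t₁` and `t₂` both represent the coset of `t₂`
  have h12 : t₁⁻¹ * t₂ ∈ H := by
    have key : ((Classical.choose (hT (g * t₂)).exists)⁻¹ * (g * t₁))⁻¹ *
        ((Classical.choose (hT (g * t₂)).exists)⁻¹ * (g * t₂)) = t₁⁻¹ * t₂ := by
      group
    rw [← key]
    exact H.mul_mem (H.inv_mem h₁) h₂
  obtain ⟨t, -, huniq⟩ := hT t₂
  have e₁ : t₁ = t := huniq t₁ ⟨ht₁, h12⟩
  have e₂ : t₂ = t := huniq t₂ ⟨ht₂, by rw [inv_mul_cancel]; exact H.one_mem⟩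
  rw [e₁, e₂]

/-- The re-indexing `t ↦ π_g(t)` is a bijection of `T` onto itself. [folklore] -/
theorem transversal_rep_bijOn {H : Subgroup G} {T : Finset G} (hT : ∀ g : G, ∃! t, t ∈ T ∧ t⁻¹ * g ∈ H) (g : G) :
    Set.BijOn (fun t => Classical.choose (hT (g * t)).exists) T T := by
  have hmaps : Set.MapsTo (fun t => Classical.choose (hT (g * t)).exists) T T := fun t _ => transversal_rep_mem hT g t
  have hinj := transversal_rep_injOn hT g
  refine ⟨hmaps, hinj, ?_⟩
  -- surjective: an injective self-map of a finite set
  have hsurj : Set.SurjOn (fun t => Classical.choose (hT (g * t)).exists) (T : Set G) T :=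
    Finset.surjOn_of_injOn_of_card_le _ (fun t ht => hmaps ht) hinj le_rfl
  exact hsurj

/-- **The transfer is the power map (commutative group)**: `∏_{t∈T} π_g(t)⁻¹ (g t) = g^{#T}`. [folklore] -/
theorem prod_transversal_cocycle_eq_pow {H : Subgroup G} {T : Finset G} (hT : ∀ g : G, ∃! t, t ∈ T ∧ t⁻¹ * g ∈ H) (g : G) :
    ∏ t ∈ T, (Classical.choose (hT (g * t)).exists)⁻¹ * (g * t) = g ^ T.card := by
  have hbij := transversal_rep_bijOn hT g
  have hπ : ∏ t ∈ T, Classical.choose (hT (g * t)).exists = ∏ t ∈ T, t :=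
    Finset.prod_nbij (fun t => Classical.choose (hT (g * t)).exists) (fun t ht => hbij.1 ht)
      (fun t₁ h₁ t₂ h₂ h => hbij.2.1 h₁ h₂ h) (fun t ht => by simpa using hbij.2.2 ht) (fun _ _ => rfl)
  rw [Finset.prod_mul_distrib, Finset.prod_mul_distrib, Finset.prod_inv_distrib, hπ, Finset.prod_const]
  rw [mul_comm, mul_assoc, mul_inv_cancel, mul_one]

/-- In particular `g^{#T} ∈ H` for every `g`. [folklore] -/
theorem pow_card_transversal_mem {H : Subgroup G} {T : Finset G} (hT : ∀ g : G, ∃! t, t ∈ T ∧ t⁻¹ * g ∈ H) (g : G) :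
    g ^ T.card ∈ H := by
  rw [← prod_transversal_cocycle_eq_pow hT g]
  exact Subgroup.prod_mem _ fun t _ => transversal_cocycle_mem hT g t

/-! ## §2 Signs -/

/-- A sign `ε ∈ {1, −1} ⊂ F` is fixed by the action. [folklore] -/
theorem smul_sign_eq (g : G) {ε : F} (hε : ε = 1 ∨ ε = -1) : g • ε = ε := by
  rcases hε with rfl | rfl
  · exact smul_one g
  · rw [smul_neg, smul_one]

/-- If `H` acts on `s` through signs, then so does it multiplicatively: there is a sign-valued function `σ` on `G` with `h • s = σ h * s` for
`h ∈ H`, and `σ (h h′) * s = σ h * σ h′ * s`. (A `choose`; no `def`.) [folklore] -/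
theorem exists_sign_function {H : Subgroup G} {s : F} (hH : ∀ h ∈ H, h • s = s ∨ h • s = -s) :
    ∃ σ : G → F, (∀ h, σ h = 1 ∨ σ h = -1) ∧ (∀ h ∈ H, h • s = σ h * s) ∧
      ∀ h ∈ H, ∀ h' ∈ H, σ (h * h') * s = σ h * σ h' * s := by
  classical
  have ha : ∀ h : G, (if h • s = s then (1 : F) else -1) = 1 ∨ (if h • s = s then (1 : F) else -1) = -1 := by
    intro h
    by_cases hh : h • s = s
    · exact Or.inl (if_pos hh)
    · exact Or.inr (if_neg hh)
  have hb : ∀ h ∈ H, h • s = (if h • s = s then (1 : F) else -1) * s := by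
    intro h hh
    by_cases hfix : h • s = s
    · rw [if_pos hfix, one_mul, hfix]
    · rw [if_neg hfix, neg_one_mul]
      exact (hH h hh).resolve_left hfix
  refine ⟨fun h => if h • s = s then 1 else -1, ha, hb, fun h hh h' hh' => ?_⟩
  -- multiplicativity on `s`: `(h h') • s = h • (σ h' · s) = σ h' · (h • s) = σ h' σ h · s`
  calc (if (h * h') • s = s then (1 : F) else -1) * s = (h * h') • s := (hb _ (H.mul_mem hh hh')).symm
    _ = h • ((if h' • s = s then (1 : F) else -1) * s) := by rw [mul_smul, ← hb h' hh']
    _ = (if h' • s = s then (1 : F) else -1) * (h • s) := by rw [smul_mul', smul_sign_eq h (ha h')]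
    _ = (if h' • s = s then (1 : F) else -1) * ((if h • s = s then (1 : F) else -1) * s) := by rw [← hb h hh]
    _ = (if h • s = s then (1 : F) else -1) * (if h' • s = s then (1 : F) else -1) * s := by ring

/-! ## §3 The half-norm `P = ∏_{t∈T} t • s` -/

/-- `P² = ∏_{t∈T} t • s²`: the transversal product of the conjugates of `a = s²` is the square of the half-norm. [folklore] -/
theorem halfNorm_sq (T : Finset G) (s : F) : (∏ t ∈ T, t • s) * (∏ t ∈ T, t • s) = ∏ t ∈ T, t • (s * s) := by
  rw [← Finset.prod_mul_distrib]
  exact Finset.prod_congr rfl fun t _ => (smul_mul' t s s).symm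

/-- The action of `g` on the half-norm: `g • P = σ(g^{#T}) · P` — spelled without `σ`: there is a sign `ε` with `g • P = ε P` and
`g^{#T} • s = ε s`. [folklore] [cite: NeukirchSchmidtWingberg2008, §1.5] -/
theorem exists_sign_smul_halfNorm {H : Subgroup G} {s : F} (hH : ∀ h ∈ H, h • s = s ∨ h • s = -s)
    {T : Finset G} (hT : ∀ g : G, ∃! t, t ∈ T ∧ t⁻¹ * g ∈ H) (g : G) :
    ∃ ε : F, (ε = 1 ∨ ε = -1) ∧ g • (∏ t ∈ T, t • s) = ε * ∏ t ∈ T, t • s ∧ (g ^ T.card) • s = ε * s := by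
  classical
  obtain ⟨σ, hσ1, hσs, hσmul⟩ := exists_sign_function hH
  -- notation
  set π : G → G := fun t => Classical.choose (hT (g * t)).exists with hπdef
  have hbij := transversal_rep_bijOn hT g
  have hcoc : ∀ t, (π t)⁻¹ * (g * t) ∈ H := fun t => transversal_cocycle_mem hT g t
  -- each factor: `(g t) • s = σ(h_{g,t}) · (π t) • s`
  have hfac : ∀ t ∈ T, g • (t • s) = σ ((π t)⁻¹ * (g * t)) * ((π t) • s) := by
    intro t _
    have e : (g * t) • s = (π t * ((π t)⁻¹ * (g * t))) • s := by rw [mul_inv_cancel_left]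
    rw [← mul_smul, e, mul_smul, hσs _ (hcoc t), smul_mul', smul_sign_eq (π t) (hσ1 _)]
  refine ⟨∏ t ∈ T, σ ((π t)⁻¹ * (g * t)), ?_, ?_, ?_⟩
  · -- a product of signs is a sign
    refine Finset.prod_induction _ (fun x : F => x = 1 ∨ x = -1) ?_ (Or.inl rfl) fun t _ => hσ1 _
    rintro a b (rfl | rfl) (rfl | rfl) <;> simp
  · rw [Finset.smul_prod', Finset.prod_congr rfl hfac, Finset.prod_mul_distrib]
    congr 1
    exact Finset.prod_nbij π (fun t ht => hbij.1 ht) (fun t₁ h₁ t₂ h₂ h => hbij.2.1 h₁ h₂ h)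
      (fun t ht => by simpa using hbij.2.2 ht) (fun _ _ => rfl)
  · -- `g^{#T} • s = σ(∏ h_{g,t}) s = (∏ σ(h_{g,t})) s`
    rw [← prod_transversal_cocycle_eq_pow hT g]
    -- induction over `T` using the multiplicativity of `σ` on `s`
    have hgen : ∀ U : Finset G, (∏ t ∈ U, (π t)⁻¹ * (g * t)) • s = (∏ t ∈ U, σ ((π t)⁻¹ * (g * t))) * s := by
      intro U
      induction U using Finset.induction_on with
      | empty => simp
      | insert a U ha ih =>
        have hmemU : (∏ t ∈ U, (π t)⁻¹ * (g * t)) ∈ H := Subgroup.prod_mem _ fun t _ => hcoc t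
        rw [Finset.prod_insert ha, Finset.prod_insert ha, hσs _ (H.mul_mem (hcoc a) hmemU), hσmul _ (hcoc a) _ hmemU,
          mul_assoc, ← hσs _ hmemU, ih, mul_assoc]
    exact hgen T

/-- ★ **If `g^{#T}` fixes `s`, then `g` fixes the half-norm.**  (`2 = 0` in `F` or `s = 0` are allowed: then everything is trivially fixed.)
[folklore] [cite: NeukirchSchmidtWingberg2008, §1.5] -/
theorem smul_halfNorm_eq_of_pow_card_smul {H : Subgroup G} {s : F} (hH : ∀ h ∈ H, h • s = s ∨ h • s = -s)
    {T : Finset G} (hT : ∀ g : G, ∃! t, t ∈ T ∧ t⁻¹ * g ∈ H) {g : G} (hg : (g ^ T.card) • s = s) :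
    g • (∏ t ∈ T, t • s) = ∏ t ∈ T, t • s := by
  classical
  obtain ⟨ε, hε, hP, hs⟩ := exists_sign_smul_halfNorm hH hT g
  rcases hε with rfl | rfl
  · rw [hP, one_mul]
  · -- `g^{#T} • s = -s = s`: then `s + s = 0`, hence `P + P = 0` (`T` is nonempty: it meets the coset of `1`), and `-P = P`
    rw [hg, neg_one_mul] at hs
    rw [hP, neg_one_mul]
    rcases T.eq_empty_or_nonempty with hTe | ⟨t₀, ht₀⟩
    · obtain ⟨t, ⟨ht, -⟩, -⟩ := hT 1
      rw [hTe] at ht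
      simp at ht
    · have h2 : t₀ • s + t₀ • s = 0 := by
        rw [← smul_add]
        have : s + s = 0 := by
          calc s + s = s + -s := by rw [← hs]
            _ = 0 := add_neg_cancel s
        rw [this, smul_zero]
      have hP2 : (∏ t ∈ T, t • s) + ∏ t ∈ T, t • s = 0 := by
        rw [← Finset.mul_prod_erase T (fun t => t • s) ht₀, ← add_mul, h2, zero_mul]
      exact (neg_eq_of_add_eq_zero_left hP2)

/-- **If `g^{#T} • s = −s`, then `g • P = −P`.** [folklore] [cite: NeukirchSchmidtWingberg2008, §1.5] -/
theorem smul_halfNorm_eq_neg_of_pow_card_smul {H : Subgroup G} {s : F} (hH : ∀ h ∈ H, h • s = s ∨ h • s = -s)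
    {T : Finset G} (hT : ∀ g : G, ∃! t, t ∈ T ∧ t⁻¹ * g ∈ H) {g : G} (hg : (g ^ T.card) • s = -s) :
    g • (∏ t ∈ T, t • s) = -∏ t ∈ T, t • s := by
  classical
  obtain ⟨ε, hε, hP, hs⟩ := exists_sign_smul_halfNorm hH hT g
  rcases hε with rfl | rfl
  · -- `-s = s`: then `P + P = 0` (`T` nonempty), so `P = -P`
    rw [hg, one_mul] at hs
    rw [hP, one_mul]
    rcases T.eq_empty_or_nonempty with hTe | ⟨t₀, ht₀⟩
    · obtain ⟨t, ⟨ht, -⟩, -⟩ := hT 1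
      rw [hTe] at ht
      simp at ht
    · have h2 : t₀ • s + t₀ • s = 0 := by
        rw [← smul_add]
        have : s + s = 0 := by
          calc s + s = -s + s := by rw [hs]
            _ = 0 := neg_add_cancel s
        rw [this, smul_zero]
      have hP2 : (∏ t ∈ T, t • s) + ∏ t ∈ T, t • s = 0 := by
        rw [← Finset.mul_prod_erase T (fun t => t • s) ht₀, ← add_mul, h2, zero_mul]
      exact (neg_eq_of_add_eq_zero_left hP2).symm
  · rw [hP, neg_one_mul]

/-- ★ **The half-norm is `G`-invariant as soon as every `g^{#T}` fixes `s`** — then the transversal product `∏_{t∈T} t • s²` of the conjugates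
of `s²` is the SQUARE of a `G`-invariant element (`halfNorm_sq`). [folklore] [cite: NeukirchSchmidtWingberg2008, §1.5] -/
theorem halfNorm_mem_fixed_of_forall_pow_card_smul {H : Subgroup G} {s : F} (hH : ∀ h ∈ H, h • s = s ∨ h • s = -s)
    {T : Finset G} (hT : ∀ g : G, ∃! t, t ∈ T ∧ t⁻¹ * g ∈ H) (hpow : ∀ g : G, (g ^ T.card) • s = s) :
    ∀ g : G, g • (∏ t ∈ T, t • s) = ∏ t ∈ T, t • s :=
  fun _ => smul_halfNorm_eq_of_pow_card_smul hH hT (hpow _)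

/-! ## §4 The order-two criterion: `#T` even and the sign element not a square in `G` -/

/-- ★ **ORDER-TWO CRITERION.**  If `#T` is even and no `g ∈ G` has `g² • s = −s` (the element of `H` acting by `−1` on `s`, if any, is NOT a
square in `G`), then `g^{#T} • s = s` for every `g` (indeed `g^{#T} = (g^{#T/2})² ∈ H` acts by a sign, which cannot be `−1`). [folklore] -/
theorem pow_card_smul_eq_of_even_of_sq_smul_ne {H : Subgroup G} {s : F} (hH : ∀ h ∈ H, h • s = s ∨ h • s = -s)
    {T : Finset G} (hT : ∀ g : G, ∃! t, t ∈ T ∧ t⁻¹ * g ∈ H) (heven : Even T.card)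
    (hsq : ∀ g : G, (g * g) • s ≠ -s) (g : G) : (g ^ T.card) • s = s := by
  obtain ⟨m, hm⟩ := heven
  rcases hH _ (pow_card_transversal_mem hT g) with h | h
  · exact h
  · exfalso
    apply hsq (g ^ m)
    rwa [← pow_add, ← hm]

/-- ★★ **Half-norm invariance from the order-two criterion**: `#T` even and no square of `G` acting by `−1` on `s` ⟹ the half-norm
`∏_{t∈T} t • s` is fixed by all of `G` (and its square is `∏_{t∈T} t • s²`). [folklore] [cite: NeukirchSchmidtWingberg2008, §1.5] -/
theorem halfNorm_mem_fixed_of_even_of_sq_smul_ne {H : Subgroup G} {s : F} (hH : ∀ h ∈ H, h • s = s ∨ h • s = -s)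
    {T : Finset G} (hT : ∀ g : G, ∃! t, t ∈ T ∧ t⁻¹ * g ∈ H) (heven : Even T.card)
    (hsq : ∀ g : G, (g * g) • s ≠ -s) :
    ∀ g : G, g • (∏ t ∈ T, t • s) = ∏ t ∈ T, t • s :=
  halfNorm_mem_fixed_of_forall_pow_card_smul hH hT fun g => pow_card_smul_eq_of_even_of_sq_smul_ne hH hT heven hsq g

/-- **Converse bookkeeping**: if some `g` has `g^{#T} • s = −s` and `2 ≠ 0`, `s ≠ 0` in a domain `F`, then the half-norm is NOT fixed by `g`,
and the transversal product `∏_{t∈T} t • s²` is not the square of any `G`-invariant element. [folklore] [cite: NeukirchSchmidtWingberg2008, §1.5] -/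
theorem halfNorm_sq_ne_sq_of_pow_card_smul_eq_neg [IsDomain F] {H : Subgroup G} {s : F} (hH : ∀ h ∈ H, h • s = s ∨ h • s = -s)
    {T : Finset G} (hT : ∀ g : G, ∃! t, t ∈ T ∧ t⁻¹ * g ∈ H) {g : G} (hg : (g ^ T.card) • s = -s)
    (h2 : (2 : F) ≠ 0) (hs : ∀ t ∈ T, t • s ≠ 0) {r : F} (hr : ∀ g' : G, g' • r = r) :
    r * r ≠ ∏ t ∈ T, t • (s * s) := by
  intro hrr
  have hP := smul_halfNorm_eq_neg_of_pow_card_smul hH hT hg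
  rw [← halfNorm_sq] at hrr
  -- `r² = P²` in a domain: `r = P` or `r = -P`; either way `g • P = P`, contradicting `g • P = -P` unless `P = 0`
  have hP0 : ∏ t ∈ T, t • s ≠ 0 := Finset.prod_ne_zero_iff.mpr hs
  have hrP : r = ∏ t ∈ T, t • s ∨ r = -∏ t ∈ T, t • s := by
    exact mul_self_eq_mul_self_iff.mp hrr
  have hfix : g • (∏ t ∈ T, t • s) = ∏ t ∈ T, t • s := by
    rcases hrP with e | e
    · rw [← e]; exact hr g
    · have : ∏ t ∈ T, t • s = -r := by rw [e, neg_neg]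
      rw [this, smul_neg, hr g]
  rw [hfix] at hP
  -- `P = -P` with `P ≠ 0` and `2 ≠ 0`
  have : (2 : F) * ∏ t ∈ T, t • s = 0 := by
    rw [two_mul]
    nth_rewrite 2 [hP]
    exact add_neg_cancel _
  rcases mul_eq_zero.mp this with e | e
  · exact h2 e
  · exact hP0 e

end Summit.BirchSwinnertonDyer.PrintCf2.HalfNormTransfer
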